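import Summits.BirchSwinnertonDyer.Rank1Residual.P2.CongruentNumberEvenAokiMonskySymbols
import Mathlib.Data.Nat.Squarefree
import Mathlib.Algebra.CharP.Two
import HarnessLib

/-!
# Cell `bsd-monsky`: AOKI = MONSKY FOR EVERY NUMBER OF PRIME FACTORS — part 3, the dictionary (ii):
# Monsky's even matrix as `( L  D_ε ; D_t  Lᵀ )`, quadratic reciprocity, and Aoki's sets on `n = 2p₁⋯p_k`
# (nothing arithmetic asserted)

HONEST FRAMING (cell `bsd-monsky`, run/shared/lean/pub/bsd-monsky/, README §1: ONE theorem on ONE explicit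
infinite family of quadratic twists of the congruent number curve at the prime `2`; not "BSD for rank ≤ 1",
nothing at odd primes, nothing booked until the cross-family referee passes the written proof). This file
asserts NO arithmetic fact and carries NO named-fact binder. With `ε_i = [p_i ≡ 3 (4)] = addLegendreSym (−1) p_i`,
`t_i = [(2/p_i) = −1] = addLegendreSym 2 p_i`, `A = legendreMatrix p`, `L = Aᵀ + D_t`:

* §2 the shape: `monskyMatrixEven p = ( L  D_ε ; D_t  Lᵀ )` and `s(n) = dim ker M`; Aoki's `λ_{p_j}(p_i) = L_ij`
  (all `i, j`, from part (i)); quadratic reciprocity `Lᵀ = L + εεᵀ + D_ε`; zero row sums `Σ_j L_ji = t_i`;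
  `ε₂(p_i) = ε_i`; and `Σ ε = 1` for `n ≡ 6 (mod 8)` (an odd number of `p_i ≡ 3 (4)`, through `χ₄`) — exactly
  the hypotheses `hLT`, `hcol`, `hodd` of the kernel count (`…EvenAokiMonskyKernel.lean`);
* §3 Aoki's sets: `S = {2} ∪ {p_i}`, `S₁ = {p_i}`, `T = T₁ = {p_i ≡ 1 (4)}` (as `n ≡ 6 (mod 8)`),
  `S₂ = {p_i ≡ 3 (4)}`, `|S| = k + 1`, `|T| = #{ε = 0}`.

References: [Aoki1999] §2 pp. 79–81, Thm. 2.2 p. 81; [HeathBrown1994SelmerCongruentII] Appendix (Monsky),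
typescript p. 39 L10–L33, p. 41 L20–L36; [IrelandRosen1990] Ch. 5 §§1–2.
-/

noncomputable section

open scoped Classical

open Matrix WeierstrassCurve Literature.NumberTheory.EllipticCurves
  Literature.NumberTheory.EllipticCurves.Aoki1999
  Literature.NumberTheory.EllipticCurves.HeathBrown1994
  Literature.NumberTheory.EllipticCurves.HeathBrown1994.Families
  Literature.NumberTheory.QuadraticForms

set_option autoImplicit false

namespace Summit.BirchSwinnertonDyer.Rank1Residual.P2.AokiMonsky

/-! ## §2 Monsky's even matrix in the shape `( L  D_ε ; D_t  Lᵀ )`, and the three structural facts -/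

section Shape

variable {k : ℕ} (p : Fin k → ℕ)

/-- `M_even = ( Aᵀ + D₂  D₋₁ ; D₂  A + D₂ ) = ( L  D_ε ; D_t  Lᵀ )` with `L = Aᵀ + D_t` (definitional
bookkeeping). [cite: HeathBrown1994SelmerCongruentII, Appendix (Monsky), typescript p. 41 L20–L36] -/
theorem monskyMatrixEven_eq_fromBlocks :
    monskyMatrixEven p =
      Matrix.fromBlocks ((legendreMatrix p)ᵀ + Matrix.diagonal fun i => addLegendreSym 2 (p i))
        (Matrix.diagonal fun i => addLegendreSym (-1) (p i))
        (Matrix.diagonal fun i => addLegendreSym 2 (p i))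
        ((legendreMatrix p)ᵀ + Matrix.diagonal fun i => addLegendreSym 2 (p i))ᵀ := by
  rw [Matrix.transpose_add, Matrix.transpose_transpose, Matrix.diagonal_transpose]
  rfl

/-- **`s(n) = dim ker M`** (rank–nullity for the square matrix `M`, `s = 2k − rank M`).
[cite: HeathBrown1994SelmerCongruentII, Appendix (Monsky), typescript p. 41 L20–L36] -/
theorem monskySelmerRankEven_eq_finrank_ker :
    monskySelmerRankEven p =
      Module.finrank (ZMod 2) ↥(LinearMap.ker (monskyMatrixEven p).mulVecLin) := by
  have h := LinearMap.finrank_range_add_finrank_ker (monskyMatrixEven p).mulVecLin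
  rw [Module.finrank_pi (ZMod 2), Fintype.card_sum, Fintype.card_fin] at h
  rw [monskySelmerRankEven, Matrix.rank]
  omega

/-- The entries of `L = Aᵀ + D_t`. [cite: HeathBrown1994SelmerCongruentII, Appendix (Monsky), typescript p. 39 L13–L26] -/
theorem shapeL_apply (i j : Fin k) :
    ((legendreMatrix p)ᵀ + Matrix.diagonal fun i => addLegendreSym 2 (p i)) i j =
      (if i = j then ∑ l ∈ Finset.univ.erase j, addLegendreSym (p l) (p j)
        else addLegendreSym (p i) (p j)) + if i = j then addLegendreSym 2 (p i) else 0 := by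
  simp only [Matrix.add_apply, Matrix.transpose_apply, legendreMatrix, Matrix.of_apply,
    Matrix.diagonal_apply]
  by_cases h : i = j
  · subst h; simp
  · simp [h, Ne.symm h]

variable (hp : ∀ i, (p i).Prime) (hodd : ∀ i, Odd (p i)) (hinj : Function.Injective p)

include hp hodd hinj in
/-- **Aoki's `λ_{p_j}(p_i)` is the `(i, j)` entry of `L = Aᵀ + D_t`** (all `i, j`).
[cite: Aoki1999, §2 p. 79] [cite: HeathBrown1994SelmerCongruentII, Appendix (Monsky), typescript p. 41 L20–L36] -/
theorem lam_prime_prime_eq_shapeL (i j : Fin k) :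
    lam (2 * ∏ i, p i) (p j) (p i) =
      ((legendreMatrix p)ᵀ + Matrix.diagonal fun i => addLegendreSym 2 (p i)) i j := by
  rw [shapeL_apply]
  by_cases h : i = j
  · subst h
    rw [if_pos rfl, if_pos rfl, lam_prime_self p hp hodd hinj i, add_comm]
  · rw [if_neg h, if_neg h, add_zero, lam_prime_prime_of_ne p hp hodd hinj h]

include hodd in
/-- `(−1/p_i) = ±1` according as `p_i ≡ 1, 3 (mod 4)` (odd `p_i`). [cite: IrelandRosen1990, Ch. 5 §1] -/
theorem jacobiSym_neg_one_eq_ite (i : Fin k) :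
    jacobiSym (-1) (p i) = if p i % 4 = 1 then 1 else -1 := by
  have h2 : ¬ p i % 2 = 0 := by have := Nat.odd_iff.mp (hodd i); omega
  rw [jacobiSym.at_neg_one (hodd i), ZMod.χ₄_nat_eq_if_mod_four, if_neg h2]

include hodd in
/-- `ε_i = [p_i ≡ 3 (mod 4)]` as a bit. [cite: IrelandRosen1990, Ch. 5 §1] -/
theorem eps_eq_ite (i : Fin k) : addLegendreSym (-1) (p i) = if p i % 4 = 1 then 0 else 1 := by
  rw [addLegendreSym_def, jacobiSym_neg_one_eq_ite p hodd i]
  by_cases h : p i % 4 = 1 <;> simp [h]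

include hodd in
/-- `ε_i = 0 ⟺ p_i ≡ 1 (mod 4)`. [cite: IrelandRosen1990, Ch. 5 §1] -/
theorem eps_eq_zero_iff (i : Fin k) : addLegendreSym (-1) (p i) = 0 ↔ p i % 4 = 1 := by
  rw [eps_eq_ite p hodd i]
  by_cases h : p i % 4 = 1 <;> simp [h]

include hodd in
/-- `ε_i` is Aoki's `ε₂(p_i)`. [cite: Aoki1999, §2 p. 80] -/
theorem epsTwo_eq (i : Fin k) : epsTwo (p i) = addLegendreSym (-1) (p i) := by
  rw [eps_eq_ite p hodd i]
  rfl

include hp hodd hinj in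
/-- **Quadratic reciprocity for the additive symbols:** `[(p_j/p_i) = −1] = [(p_i/p_j) = −1] + ε_i ε_j`
for `i ≠ j`, `ε = [· ≡ 3 (mod 4)]`. [cite: IrelandRosen1990, Ch. 5 §2 Thm. 1] -/
theorem addLegendreSym_swap {i j : Fin k} (hij : i ≠ j) :
    addLegendreSym (p j) (p i) =
      addLegendreSym (p i) (p j) + addLegendreSym (-1) (p i) * addLegendreSym (-1) (p j) := by
  have hpi : Odd (p i) := hodd i
  have hpj : Odd (p j) := hodd j
  have hsym : jacobiSym (p i) (p j) = 1 ∨ jacobiSym (p i) (p j) = -1 :=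
    jacobiSym_prime_prime_eq_one_or p hp hinj hij
  rw [eps_eq_ite p hodd i, eps_eq_ite p hodd j]
  by_cases hi : p i % 4 = 1
  · rw [if_pos hi, zero_mul, add_zero, addLegendreSym_def, addLegendreSym_def,
      jacobiSym.quadratic_reciprocity_one_mod_four' hpj hi]
  · by_cases hj : p j % 4 = 1
    · rw [if_pos hj, mul_zero, add_zero, addLegendreSym_def, addLegendreSym_def,
        jacobiSym.quadratic_reciprocity_one_mod_four hj hpi]
    · have hi3 : p i % 4 = 3 := by have := Nat.odd_iff.mp hpi; omega
      have hj3 : p j % 4 = 3 := by have := Nat.odd_iff.mp hpj; omega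
      rw [if_neg hi, if_neg hj, mul_one, addLegendreSym_def, addLegendreSym_def,
        jacobiSym.quadratic_reciprocity_three_mod_four hj3 hi3]
      rcases hsym with h | h <;> rw [h] <;> decide

include hp hodd hinj in
/-- **`Lᵀ = L + εεᵀ + D_ε`** for `L = Aᵀ + D_t` (quadratic reciprocity, entrywise).
[cite: IrelandRosen1990, Ch. 5 §2 Thm. 1] [cite: HeathBrown1994SelmerCongruentII, Appendix (Monsky), typescript p. 41 L20–L36] -/
theorem shapeL_transpose (i j : Fin k) :
    ((legendreMatrix p)ᵀ + Matrix.diagonal fun i => addLegendreSym 2 (p i)) j i =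
      ((legendreMatrix p)ᵀ + Matrix.diagonal fun i => addLegendreSym 2 (p i)) i j +
        addLegendreSym (-1) (p i) * addLegendreSym (-1) (p j) +
        if i = j then addLegendreSym (-1) (p i) else 0 := by
  rw [shapeL_apply, shapeL_apply]
  by_cases h : i = j
  · subst h
    simp only [if_true]
    have : ∀ x y e : ZMod 2, x + y = x + y + e * e + e := by decide
    exact this _ _ _
  · rw [if_neg (Ne.symm h), if_neg (Ne.symm h), if_neg h, if_neg h, if_neg h, add_zero, add_zero,
      add_zero, addLegendreSym_swap p hp hodd hinj h]

/-- **Zero row sums of `A`: `Σ_j L_ji = t_i`.** [cite: HeathBrown1994SelmerCongruentII, Appendix (Monsky), typescript p. 39 L13–L26] -/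
theorem shapeL_sum_col (i : Fin k) :
    ∑ j, ((legendreMatrix p)ᵀ + Matrix.diagonal fun i => addLegendreSym 2 (p i)) j i =
      addLegendreSym 2 (p i) := by
  simp only [Matrix.add_apply, Matrix.transpose_apply, Matrix.diagonal_apply, Finset.sum_add_distrib,
    Finset.sum_ite_eq', Finset.mem_univ, if_true]
  suffices h : ∑ j, legendreMatrix p i j = 0 by rw [h, zero_add]
  rw [← Finset.add_sum_erase _ _ (Finset.mem_univ i)]
  simp only [legendreMatrix, Matrix.of_apply, if_true]
  rw [Finset.sum_congr rfl fun j hj => if_neg (Ne.symm (Finset.mem_erase.mp hj).1)]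
  exact CharTwo.add_self_eq_zero _

include hodd in
/-- **`Σ ε_i = 1` when `n = 2p₁⋯p_k ≡ 6 (mod 8)`** (an odd number of `p_i ≡ 3 (mod 4)`, since
`∏ p_i ≡ 3 (mod 4)`): through the character `χ₄`. [cite: IrelandRosen1990, Ch. 5 §1] -/
theorem sum_eps_eq_one (h8 : (2 * ∏ i, p i) % 8 = 6) : ∑ i, addLegendreSym (-1) (p i) = 1 := by
  have hP : (∏ i, p i) % 4 = 3 := by omega
  have hχ : ZMod.χ₄ ((∏ i, p i : ℕ) : ZMod 4) = -1 := ZMod.χ₄_nat_three_mod_four hP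
  rw [Nat.cast_prod, map_prod] at hχ
  have hsigns : ∀ i ∈ (Finset.univ : Finset (Fin k)),
      ZMod.χ₄ ((p i : ℕ) : ZMod 4) = 1 ∨ ZMod.χ₄ ((p i : ℕ) : ZMod 4) = -1 := by
    intro i _
    rw [ZMod.χ₄_nat_eq_if_mod_four, if_neg (by have := Nat.odd_iff.mp (hodd i); omega)]
    split_ifs <;> simp
  rw [prod_sign_eq_ite_sum_bits _ _ hsigns] at hχ
  have hne : (∑ i, if ZMod.χ₄ ((p i : ℕ) : ZMod 4) = 1 then (0 : ZMod 2) else 1) ≠ 0 := by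
    intro h0; rw [if_pos h0] at hχ; exact absurd hχ (by decide)
  have h01 : ∀ x : ZMod 2, x = 0 ∨ x = 1 := by decide
  have heq : (∑ i, if ZMod.χ₄ ((p i : ℕ) : ZMod 4) = 1 then (0 : ZMod 2) else 1) =
      ∑ i, addLegendreSym (-1) (p i) :=
    Finset.sum_congr rfl fun i _ => by rw [addLegendreSym_def, jacobiSym.at_neg_one (hodd i)]
  rw [heq] at hne
  exact (h01 _).resolve_left hne

end Shape

/-! ## §3 Aoki's sets on `n = 2p₁⋯p_k ≡ 6 (mod 8)` -/

section Sets

variable {k : ℕ} (p : Fin k → ℕ) (hp : ∀ i, (p i).Prime) (hodd : ∀ i, Odd (p i))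
  (hinj : Function.Injective p)

include hinj in
/-- `∏ pᵢ` over `Fin k` is the product over the image finset. [folklore] -/
theorem prod_eq_prod_image : ∏ i, p i = ∏ q ∈ Finset.univ.image p, q := by
  rw [Finset.prod_image fun i _ j _ h => hinj h]

include hp hinj in
/-- `S = {2} ∪ {p₁, …, p_k}` for `n = 2p₁⋯p_k`. [cite: Aoki1999, §2 p. 80] -/
theorem sSet_two_mul_prod : sSet (2 * ∏ i, p i) = insert 2 (Finset.univ.image p) := by
  unfold sSet
  rw [Nat.primeFactors_mul two_ne_zero (Finset.prod_ne_zero_iff.mpr fun i _ => (hp i).ne_zero),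
    Nat.prime_two.primeFactors, prod_eq_prod_image p hinj,
    Nat.primeFactors_prod (by simpa using fun i => hp i), Finset.insert_eq]

include hp hodd hinj in
/-- `S₁ = {p₁, …, p_k}` (the odd primes of `n`). [cite: Aoki1999, §2 p. 80, Thm. 6.1 p. 93] -/
theorem sOneSet_two_mul_prod : sOneSet (2 * ∏ i, p i) = Finset.univ.image p := by
  unfold sOneSet
  rw [sSet_two_mul_prod p hp hinj, Finset.filter_insert, if_neg (fun h => h rfl),
    Finset.filter_true_of_mem]
  intro x hx
  obtain ⟨i, -, rfl⟩ := Finset.mem_image.mp hx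
  exact prime_ne_two p hodd i

include hp hinj in
/-- `T = T₁ = {p_i ≡ 1 (mod 4)}` for `n ≡ 6 (mod 8)`. [cite: Aoki1999, §2 p. 80] -/
theorem tSet_two_mul_prod (h8 : (2 * ∏ i, p i) % 8 = 6) :
    tSet (2 * ∏ i, p i) = (Finset.univ.filter fun i => p i % 4 = 1).image p := by
  unfold tSet tOneSet
  rw [if_neg (by omega), sSet_two_mul_prod p hp hinj, Finset.filter_insert, if_neg (by decide),
    Finset.filter_image]

include hp hodd hinj in
/-- `S₂ = S₁ ∖ T = {p_i ≡ 3 (mod 4)}` for `n ≡ 6 (mod 8)`. [cite: Aoki1999, Thm. 2.2 p. 81] -/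
theorem sTwoSet_two_mul_prod (h8 : (2 * ∏ i, p i) % 8 = 6) :
    sTwoSet (2 * ∏ i, p i) = (Finset.univ.filter fun i => ¬ p i % 4 = 1).image p := by
  unfold sTwoSet
  rw [sOneSet_two_mul_prod p hp hodd hinj, tSet_two_mul_prod p hp hinj h8, Finset.filter_not,
    Finset.image_sdiff _ _ hinj]

include hp hodd hinj in
/-- `|S| = k + 1`. [cite: Aoki1999, §2 p. 80] -/
theorem card_sSet_two_mul_prod : (sSet (2 * ∏ i, p i)).card = k + 1 := by
  rw [sSet_two_mul_prod p hp hinj, Finset.card_insert_of_notMem, Finset.card_image_of_injective _ hinj,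
    Finset.card_univ, Fintype.card_fin]
  intro h
  obtain ⟨i, -, hi⟩ := Finset.mem_image.mp h
  exact prime_ne_two p hodd i hi

include hp hodd hinj in
/-- `|T| = #{i : ε_i = 0}`. [cite: Aoki1999, §2 p. 80] -/
theorem card_tSet_two_mul_prod (h8 : (2 * ∏ i, p i) % 8 = 6) :
    (tSet (2 * ∏ i, p i)).card = Fintype.card {i : Fin k // addLegendreSym (-1) (p i) = 0} := by
  rw [tSet_two_mul_prod p hp hinj h8, Finset.card_image_of_injective _ hinj, Fintype.card_subtype]
  congr 1
  ext i
  simp only [Finset.mem_filter, Finset.mem_univ, true_and, eps_eq_zero_iff p hodd i]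

end Sets

end Summit.BirchSwinnertonDyer.Rank1Residual.P2.AokiMonsky

end
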